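import Summits.QuantumFields.YangMills.Theorems.FemtoCutoffLadderThinningAveraged
import Summits.QuantumFields.YangMills.Theorems.FemtoCutoffLadderSubOctaveBoundedUpStepMoments
import Summits.QuantumFields.YangMills.Theorems.FemtoCutoffLadderSubOctaveBoundedReshape
import Summits.QuantumFields.YangMills.Theorems.FemtoCutoffLadderDyadicNestedUpperDirichlet
import Summits.QuantumFields.YangMills.Theorems.FemtoTransferGapEigenbasis
import HarnessLib

/-!
# SKETCH (evidence, not a tree file): the PINNED, DE-ALIASED, TIME-1 upward step «PinnedUpStep» — proposed restatement text for crux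
# `SubOctaveBounded` (stmt-QuantumFields-24085) / LINE g5-B (26477), and its kernel-checked glue to `UpStepEv` and to the leaf

Seat ym-line-fcl-p3 g4 (2026-08-28).  R2b1 RECORD rung; nothing here proves any item.  `PinnedUpStep` below is the statement of
`Cruxes/SubOctaveBounded/BEP-26477.md §5`: ONE incommensurable pair `L₀ ≤ L' < L < 2L'` (threshold after the level), the fine positive ground
state `Ω`, the coarse positive ground state `Ω' ≥ c' > 0` and a coarse first-excited eigenfunction `φ'`, the TRANSLATION-AVERAGED thinning pull-back
`f̄ = |Λ_L|⁻¹ Σ_v (φ'/Ω') ∘ thin L' ∘ τ_v`, the pinned trial vector `ψ̄ = f̄·Ω`, and the physical-time-1 moment inequality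
`λ₁(L')^{L'}·λ₀(L)^L·Var ≤ e^{CΛ²}·λ₀(L')^{L'}·(⟨ψ̄, K_β^L ψ̄⟩ − λ₀(L)^L⟨ψ̄,Ω⟩²)`, `Var = ‖ψ̄‖² − ⟨ψ̄,Ω⟩² > 0`.
Glues (proved here): `upStepEv_of_pinnedUpStep` (→ the `UpStepEv` body of RESHAPE.md §Certificate 2, via the door argument of
`UpStep.upStepAt_of_moments` run on the positive ground state) and `femtoGapOfRecord_of_octave_pinnedUpStep_fixedLattice`
(`OctaveStepDecay → PinnedUpStep → FemtoGapFixedLattice → FemtoGapOfRecord`, by `femtoGapOfRecord_of_octave_upStep_fixedLattice`).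
-/

set_option autoImplicit false

noncomputable section

open MeasureTheory
open Literature.MathematicalPhysics.QuantumFieldTheory (GaugeConfig Site Edge gaugeTransform)
open Literature.MathematicalPhysics.QuantumFieldTheory.TorusTranslation (torusConfigShift)

namespace Summit.QuantumFields.YangMills.Theorems.FemtoCutoffLadder.PinnedUpStepSketch

open Summit.QuantumFields.YangMills.Theorems.FemtoTransferGap
open Summit.QuantumFields.YangMills.Theorems.FemtoCutoffLadder.Thinning (thin isPhys_avg_thin_shift)
open Summit.QuantumFields.YangMills.Theses.FemtoCutoffLadder (OctaveStepDecay)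

/-- **Proposed route decl «PinnedUpStep»** (adoption-ready text; route vocabulary, pointwise eigen-equations as in 26477). [cite: Luscher1983] -/
def PinnedUpStep : Prop :=
  ∃ C lam0 : ℝ, 0 < lam0 ∧ ∀ lam : ℝ, 0 < lam → lam ≤ lam0 → ∃ L0 : ℕ,
    ∀ (L' : ℕ) [NeZero L'] (L : ℕ) [NeZero L], L0 ≤ L' → L' < L → L < 2 * L' → ∀ β β' : ℝ,
      InFemtoWindow lam β L → InFemtoWindow lam β' L' → luscherLambda β L = luscherLambda β' L' →
      ∀ Ω : GaugeConfig 3 L SU2 → ℝ, IsPhys Ω → (∀ U, 0 < Ω U) → l2 Ω Ω = 1 →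
        (∀ U, ∫ V, transferKernel su2Rep β U V * Ω V ∂(configMeasure SU2 L) = topValue su2Rep L β * Ω U) →
      ∀ Ω' : GaugeConfig 3 L' SU2 → ℝ, IsPhys Ω' → ∀ c' : ℝ, 0 < c' → (∀ U', c' ≤ Ω' U') → l2 Ω' Ω' = 1 →
        (∀ U', ∫ V', transferKernel su2Rep β' U' V' * Ω' V' ∂(configMeasure SU2 L') = topValue su2Rep L' β' * Ω' U') →
      ∀ φ' : GaugeConfig 3 L' SU2 → ℝ, IsPhys φ' → l2 φ' Ω' = 0 → l2 φ' φ' = 1 →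
        (∀ U', ∫ V', transferKernel su2Rep β' U' V' * φ' V' ∂(configMeasure SU2 L') = secondValue su2Rep L' β' * φ' U') →
      let ψ : GaugeConfig 3 L SU2 → ℝ := fun U =>
        ((Fintype.card (Site 3 L) : ℝ)⁻¹ *
          ∑ v : Site 3 L, φ' (Thinning.thin L' (torusConfigShift v U)) / Ω' (Thinning.thin L' (torusConfigShift v U))) * Ω U
      let K : (GaugeConfig 3 L SU2 → ℝ) → (GaugeConfig 3 L SU2 → ℝ) := fun χ U => ∫ V, transferKernel su2Rep β U V * χ V ∂(configMeasure SU2 L)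
      l2 ψ Ω ^ 2 < l2 ψ ψ ∧
        secondValue su2Rep L' β' ^ L' * topValue su2Rep L β ^ L * (l2 ψ ψ - l2 ψ Ω ^ 2) ≤
          Real.exp (C * luscherLambda β L ^ 2) * (topValue su2Rep L' β' ^ L' * (l2 ψ (K^[L] ψ) - topValue su2Rep L β ^ L * l2 ψ Ω ^ 2))

/-- ★ **Glue: `PinnedUpStep →` the `UpStepEv` body** (fine gap ≤ coarse gap + CΛ² at every pair `L₀(lam) ≤ L' < L < 2L'`).  The door argument of
`UpStep.upStepAt_of_moments` run on the POSITIVE fine ground state of `PhysL2.exists_groundState`; the coarse data from `exists_isPhys_eigenseq`;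
physicality of the averaged pull-back from `Thinning.isPhys_avg_thin_shift` + `Dirichlet.ratio_multiplier`. [cite: ReedSimonIV1978, Thm. XIII.1] -/
theorem upStepEv_of_pinnedUpStep (h : PinnedUpStep) :
    ∃ C lam0 : ℝ, 0 < lam0 ∧ ∀ lam : ℝ, 0 < lam → lam ≤ lam0 → ∃ L0 : ℕ,
      ∀ (L' : ℕ) [NeZero L'] (L : ℕ) [NeZero L], L0 ≤ L' → L' < L → L < 2 * L' → ∀ β β' : ℝ,
        InFemtoWindow lam β L → InFemtoWindow lam β' L' → luscherLambda β L = luscherLambda β' L' →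
          secondValue su2Rep L' β' ^ L' * topValue su2Rep L β ^ L ≤
            Real.exp (C * luscherLambda β L ^ 2) * (secondValue su2Rep L β ^ L * topValue su2Rep L' β' ^ L') := by
  obtain ⟨C, lam0, hlam0, H⟩ := h
  refine ⟨C, lam0, hlam0, fun lam hlam hle => ?_⟩
  obtain ⟨L0, HL⟩ := H lam hlam hle
  refine ⟨L0, fun L' _ L _ hL0 hlt hlt2 β β' hW hW' hm => ?_⟩
  have hLL : L' ≤ L := hlt.le
  have h2 : L ≤ 2 * L' := hlt2.le
  have hβ0 : 0 < β := zero_lt_one.trans_le hW.1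
  have hβ' : 0 < β' := zero_lt_one.trans_le hW'.1
  have hL1 : 1 ≤ L := NeZero.one_le
  -- fine positive ground state
  obtain ⟨Ω, θ, c, hΩ, hc, hcle, hn, heig, -, -, -⟩ := PhysL2.exists_groundState (L := L) β
  have hpos : ∀ U, 0 < Ω U := fun U => hc.trans_le (hcle U)
  -- coarse ground state and first excitation
  obtain ⟨Ω', θ', c', hΩ', hc', hcle', hn', heig', -, -, -⟩ := PhysL2.exists_groundState (L := L') β'
  obtain ⟨e, hon, heige, -, -⟩ := exists_isPhys_eigenseq (L := L') hβ'
  set φ' : GaugeConfig 3 L' SU2 → ℝ := ((e 1 : physSubmodule L') : GaugeConfig 3 L' SU2 → ℝ) with hφ'def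
  have hφ' : IsPhys φ' := (e 1).2
  have hn1 : l2 φ' φ' = 1 := by have := hon 1 1; simpa using this
  have heig1 : transferApply β' φ' = secondValue su2Rep L' β' • φ' := by
    rw [← levelValue_one]; exact heige 1
  have horth : l2 φ' Ω' = 0 :=
    Dirichlet.l2_eq_zero_of_eigen_ne β' hφ' hΩ' heig1 heig' (PhysL2.secondValue_lt_topValue (L := L') β').ne
  -- pointwise eigen-equations
  have heigp : ∀ U, ∫ V, transferKernel su2Rep β U V * Ω V ∂(configMeasure SU2 L) = topValue su2Rep L β * Ω U :=
    fun U => by simpa [transferApply] using congrFun heig U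
  have heigp' : ∀ U', ∫ V', transferKernel su2Rep β' U' V' * Ω' V' ∂(configMeasure SU2 L') = topValue su2Rep L' β' * Ω' U' :=
    fun U => by simpa [transferApply] using congrFun heig' U
  have heigp1 : ∀ U', ∫ V', transferKernel su2Rep β' U' V' * φ' V' ∂(configMeasure SU2 L') = secondValue su2Rep L' β' * φ' U' :=
    fun U => by simpa [transferApply] using congrFun heig1 U
  -- the pinned statement at this pair
  have HB := HL L' L hL0 hlt hlt2 β β' hW hW' hm Ω hΩ hpos hn heigp Ω' hΩ' c' hc' hcle' hn' heigp' φ' hφ' horth hn1 heigp1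
  simp only [] at HB
  obtain ⟨hvar, hineq⟩ := HB
  -- the averaged pull-back is a physical multiplier; the pinned vector is physical
  obtain ⟨hrm, ⟨Cg, hrb⟩, hrg, hrz, -⟩ := Dirichlet.ratio_multiplier hΩ' hφ' hc' hcle'
  have hg : IsPhys (fun U' : GaugeConfig 3 L' SU2 => φ' U' / Ω' U') := ⟨hrm, ⟨Cg, hrb⟩, hrg, hrz⟩
  have hf := isPhys_avg_thin_shift hLL h2 hg
  obtain ⟨Cf, hCf⟩ := hf.bounded
  set w : GaugeConfig 3 L SU2 → ℝ := fun U =>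
    ((Fintype.card (Site 3 L) : ℝ)⁻¹ *
      ∑ v : Site 3 L, φ' (thin L' (torusConfigShift v U)) / Ω' (thin L' (torusConfigShift v U))) * Ω U with hwdef
  have hw : IsPhys w := hΩ.mul_of_invariant hf.measurable hCf hf.gaugeInv hf.zeroFlux
  -- `K^[L]` in route vocabulary is `(transferApply β)^[L]`
  have hK : (fun (χ : GaugeConfig 3 L SU2 → ℝ) (U : GaugeConfig 3 L SU2) =>
      ∫ V, transferKernel su2Rep β U V * χ V ∂(configMeasure SU2 L)) = transferApply (L := L) β := by
    funext χ U; rfl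
  rw [hK] at hineq
  -- door argument on `v = w − ⟨w,Ω⟩Ω`
  obtain ⟨hv, hvΩ, hnorm, htwo⟩ := UpStep.recentred_moments β hΩ hn heig hw L
  set v : GaugeConfig 3 L SU2 → ℝ := w + (-(l2 w Ω)) • Ω with hvdef
  have hvpos : 0 < l2 v v := by rw [hnorm]; linarith
  have hcmp : secondValue su2Rep L' β' ^ L' * topValue su2Rep L β ^ L * l2 v v ≤
      Real.exp (C * luscherLambda β L ^ 2) * (topValue su2Rep L' β' ^ L' * l2 v ((transferApply β)^[L] v)) := by
    rw [hnorm, htwo]; exact hineq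
  have hvarb := UpStep.l2_iterate_le_pow_secondValue hβ0 hΩ hn heig hv hvΩ hL1
  have hb' : 0 ≤ topValue su2Rep L' β' ^ L' := pow_nonneg (topValue_su2Rep_pos L' β').le _
  have h1 : Real.exp (C * luscherLambda β L ^ 2) * (topValue su2Rep L' β' ^ L' * l2 v ((transferApply β)^[L] v)) ≤
      Real.exp (C * luscherLambda β L ^ 2) * (topValue su2Rep L' β' ^ L' * (secondValue su2Rep L β ^ L * l2 v v)) :=
    mul_le_mul_of_nonneg_left (mul_le_mul_of_nonneg_left hvarb hb') (Real.exp_pos _).le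
  have h3 : (secondValue su2Rep L' β' ^ L' * topValue su2Rep L β ^ L) * l2 v v ≤
      (Real.exp (C * luscherLambda β L ^ 2) * (secondValue su2Rep L β ^ L * topValue su2Rep L' β' ^ L')) * l2 v v := by
    calc (secondValue su2Rep L' β' ^ L' * topValue su2Rep L β ^ L) * l2 v v
        = secondValue su2Rep L' β' ^ L' * topValue su2Rep L β ^ L * l2 v v := by ring
      _ ≤ Real.exp (C * luscherLambda β L ^ 2) * (topValue su2Rep L' β' ^ L' * (secondValue su2Rep L β ^ L * l2 v v)) := hcmp.trans h1
      _ = (Real.exp (C * luscherLambda β L ^ 2) * (secondValue su2Rep L β ^ L * topValue su2Rep L' β' ^ L')) * l2 v v := by ring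
  exact le_of_mul_le_mul_right h3 hvpos

/-- ★★ **Route FemtoCutoffLadder closes the leaf from `OctaveStepDecay` + `PinnedUpStep` + the fixed-lattice law** (composition with
`femtoGapOfRecord_of_octave_upStep_fixedLattice`). [cite: LuscherWeiszWolff1991] [cite: Luscher1983, §3] -/
theorem femtoGapOfRecord_of_octave_pinnedUpStep_fixedLattice (h₁ : OctaveStepDecay) (hP : PinnedUpStep)
    (hFL : FemtoGapFixedLattice) : FemtoGapOfRecord :=
  femtoGapOfRecord_of_octave_upStep_fixedLattice h₁ (upStepEv_of_pinnedUpStep hP) hFL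

/-- ★★ **Assembly shape for a route whose step item is `UpStepEv`** (RESHAPE.md §Certificate 2): `OctaveStepDecay → UpStepEv → CoarsePairScaling →
OneSiteWindowAnchor → MatchedCouplingExists → FemtoGapOfRecord` — the shape of `Assembly2` with the step item
replaced (ladder `CutoffLadder.femtoGapOfRecord_of_towerLadder_up`). [cite: LuscherWeiszWolff1991] -/
theorem assembly_of_octave_upStepEv_coarsePairs (h₁ : OctaveStepDecay)
    (hU : ∃ C lam0 : ℝ, 0 < lam0 ∧ ∀ lam : ℝ, 0 < lam → lam ≤ lam0 → ∃ L0 : ℕ,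
      ∀ (L' : ℕ) [NeZero L'] (L : ℕ) [NeZero L], L0 ≤ L' → L' < L → L < 2 * L' → ∀ β β' : ℝ,
        InFemtoWindow lam β L → InFemtoWindow lam β' L' → luscherLambda β L = luscherLambda β' L' →
          secondValue su2Rep L' β' ^ L' * topValue su2Rep L β ^ L ≤
            Real.exp (C * luscherLambda β L ^ 2) * (secondValue su2Rep L β ^ L * topValue su2Rep L' β' ^ L'))
    (h₃ : Theses.FemtoCutoffLadder.CoarsePairScaling) (h₄ : Theses.FemtoCutoffLadder.OneSiteWindowAnchor)
    (h₅ : Theses.FemtoCutoffLadder.MatchedCouplingExists) : FemtoGapOfRecord :=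
  CutoffLadder.femtoGapOfRecord_of_towerLadder_up h₁ hU (coarsePairs_pow_of_coarsePairScaling h₃) h₄ h₅

/-- ★★ **Assembly shape for a route whose step item is `PinnedUpStep`**: `OctaveStepDecay → PinnedUpStep → CoarsePairScaling → OneSiteWindowAnchor →
MatchedCouplingExists → FemtoGapOfRecord`. [cite: LuscherWeiszWolff1991] -/
theorem assembly_of_octave_pinnedUpStep_coarsePairs (h₁ : OctaveStepDecay) (hP : PinnedUpStep)
    (h₃ : Theses.FemtoCutoffLadder.CoarsePairScaling) (h₄ : Theses.FemtoCutoffLadder.OneSiteWindowAnchor)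
    (h₅ : Theses.FemtoCutoffLadder.MatchedCouplingExists) : FemtoGapOfRecord :=
  CutoffLadder.femtoGapOfRecord_of_towerLadder_up h₁ (upStepEv_of_pinnedUpStep hP) (coarsePairs_pow_of_coarsePairScaling h₃) h₄ h₅

end Summit.QuantumFields.YangMills.Theorems.FemtoCutoffLadder.PinnedUpStepSketch

end
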